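import Mathlib
import Summits.Ventures.PercRepro2.HCov
import Summits.Ventures.PercRepro2.EdgeCubic
import Summits.Ventures.PercRepro2.EdgeCubicAll
import Summits.Ventures.PercRepro2.CPolarA3
import Summits.Ventures.PercRepro2.CPolarA3Marks
import Summits.Ventures.PercRepro2.CPolarA3Exists
import Summits.Ventures.PercRepro2.EdgeReloc
import Summits.Ventures.PercRepro2.ReachRootEdge
import Summits.Ventures.PercRepro2.CPolarSub
import Summits.Ventures.PercRepro2.CPolarSubLit
import Summits.Ventures.PercRepro2.CPolarSubPlus
import Summits.Ventures.PercRepro2.CPolarSubNP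
import Summits.Ventures.PercRepro2.InternalEdge

/-!
# THE LITERAL FORM OF THE FINAL OPEN HYPOTHESIS (H2) — (SUB) at one LITERAL `a₃`-edge of every
mark-free non-null instance whose fractional reach-edges are all incident to `a₃`, are all
boundary edges, and number at least two (blind cell PercRepro2, p5 g17; `proofs/P5-OEDGE.md` §23)

`InternalEdge.HCov_all_of_cpolarA3SubB2_all` asks (SUB) at one boundary edge of every mark-free
non-null instance with no internal fractional reach-edge and no pendant edge. By repeated
relocation (`CPolarSubLit`) every fractional boundary edge `{z, u}` (`z` in the reach of `a₃`,
`u` outside) can be moved to `{a₃, u}`; a relocation changes no reach, so it preserves the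
internal / pendant / touching status of every edge (**`isInternalEdge_reloc_iff`**,
**`isPendantEdge_reloc_iff`**) and the non-nullity of `Q`, and `GoodEdgeSub` transfers back
(`goodEdgeSub_of_reloc`). Hence **`cpolarA3SubB2_all_of_lit`** and
**`HCov_all_of_cpolarA3SubB2Lit_all : HCovPlus_all R → CPolarA3SubB2Lit_all R → HCov_all R`**:
the open hypothesis of the road is (H1) `HCovPlus_all` and (H2′) (SUB) at one of the ≥ 2 literal
fractional edges `{a₃, u}` of a mark-free non-null instance in which every fractional edge
touching the reach of `a₃` is such a literal boundary edge — the contracted `o`-edges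
(P1, P2 ≥ 0) and class (α), read at the vertex `a₃` itself.
-/

namespace Summit.Ventures.PercRepro2

open UnionCluster CovForm CovForm.CPolarA3 CPolarA3Exists ReachRoot EdgeReloc CPolarSub
  CPolarSubLit CPolarSubPlus CPolarSubNP InternalEdge

namespace CPolarSubB2Lit

open EdgeLine

/-! ## What one relocation preserves: internal edges, pendant edges, the mass of `Q` -/

section Transfer

variable {V E : Type} [Fintype V] [DecidableEq V] [Fintype E] [DecidableEq E]
  {R : Type*} [Field R] [LinearOrder R] [IsStrictOrderedRing R]

variable {p : E → R} {ends : E → Sym2 V} {e : E} {a₃ z u : V}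

omit [Fintype V] [DecidableEq V] [Fintype E] [IsStrictOrderedRing R] in
/-- Being an internal fractional reach-edge is unchanged by relocating the end `z ∈ reach(a₃)` of
`e` to `a₃` (the reach is unchanged; for `e` itself both ends `z`, `a₃` lie in the reach). -/
lemma isInternalEdge_reloc_iff (hf1 : p e ≠ 1) (hz : z ∈ pinnedReach p ends a₃)
    (he : ends e = s(z, u)) (e' : E) :
    IsInternalEdge p (Function.update ends e s(a₃, u)) a₃ e' ↔ IsInternalEdge p ends a₃ e' := by
  unfold IsInternalEdge
  rw [pinnedReach_reloc p hf1]
  by_cases hee : e' = e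
  · subst hee
    rw [Function.update_self, he]
    constructor
    · rintro ⟨x, y, hxy, hx, hy⟩
      refine ⟨z, u, rfl, hz, ?_⟩
      rcases Sym2.eq_iff.1 hxy with ⟨_, huy⟩ | ⟨_, hux⟩
      · exact huy ▸ hy
      · exact hux ▸ hx
    · rintro ⟨x, y, hxy, hx, hy⟩
      refine ⟨a₃, u, rfl, self_mem_pinnedReach, ?_⟩
      rcases Sym2.eq_iff.1 hxy with ⟨_, huy⟩ | ⟨_, hux⟩
      · exact huy ▸ hy
      · exact hux ▸ hx
  · rw [Function.update_of_ne hee]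

omit [Fintype V] [DecidableEq V] [IsStrictOrderedRing R] in
/-- Being a pendant edge is unchanged by a relocation (uniqueness of the touching edge and the
boundary shape both survive: the reach is unchanged, and `e` keeps one end in the reach). -/
lemma isPendantEdge_reloc_iff (hf1 : p e ≠ 1) (hz : z ∈ pinnedReach p ends a₃)
    (he : ends e = s(z, u)) (f : E) :
    IsPendantEdge p (Function.update ends e s(a₃, u)) a₃ f ↔ IsPendantEdge p ends a₃ f := by
  unfold IsPendantEdge
  rw [pinnedReach_reloc p hf1]
  have huniq : (∀ e' ∈ fracEdges p, TouchesReach p (Function.update ends e s(a₃, u)) a₃ e' → e' = f)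
      ↔ ∀ e' ∈ fracEdges p, TouchesReach p ends a₃ e' → e' = f := by
    constructor
    · intro h e' he' ht
      exact h e' he' ((touchesReach_reloc_iff hf1 hz he e').2 ht)
    · intro h e' he' ht
      exact h e' he' ((touchesReach_reloc_iff hf1 hz he e').1 ht)
  rw [huniq]
  refine and_congr_right fun _ => ?_
  by_cases hef : f = e
  · subst hef
    rw [Function.update_self, he]
    constructor
    · rintro ⟨x, y, hxy, hx, hy⟩
      rcases Sym2.eq_iff.1 hxy with ⟨_, huy⟩ | ⟨hay, _⟩
      · exact ⟨z, u, rfl, hz, huy ▸ hy⟩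
      · exact absurd (hay ▸ self_mem_pinnedReach) hy
    · rintro ⟨x, y, hxy, hx, hy⟩
      rcases Sym2.eq_iff.1 hxy with ⟨_, huy⟩ | ⟨hzy, _⟩
      · exact ⟨a₃, u, rfl, self_mem_pinnedReach, huy ▸ hy⟩
      · exact absurd (hzy ▸ hz) hy
  · rw [Function.update_of_ne hef]

omit [Fintype V] [DecidableEq V] [IsStrictOrderedRing R] in
/-- The mass of `Q` is unchanged by a relocation. -/
lemma prob_Q_reloc (hf1 : p e ≠ 1) (hz : z ∈ pinnedReach p ends a₃) (he : ends e = s(z, u))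
    (a₁ a₂ : V) :
    prob p (avoidAll (Function.update ends e s(a₃, u)) a₂ {a₁}) = prob p (avoidAll ends a₂ {a₁}) :=
  (prob_Q (hH_of_reloc hf1 hz he (self_keeps_one p e)) a₁ a₂).symm

end Transfer

/-! ## The literal form of (H2) -/

section Lit

variable (R : Type*) [Field R] [LinearOrder R] [IsStrictOrderedRing R]

/-- **(H2′): (SUB) at one LITERAL `a₃`-edge of every mark-free non-null instance whose fractional
reach-edges are all incident to `a₃`, with no internal fractional reach-edge and no pendant edge**
(hence with at least two fractional edges `{a₃, u}`, `u` outside the reach). -/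
def CPolarA3SubB2Lit_all : Prop :=
  ∀ (V E : Type) [Fintype V] [DecidableEq V] [Fintype E] [DecidableEq E]
    (ends : E → Sym2 V) (p : E → R), IsProbVec p →
    ∀ o a₁ a₂ a₃ b : V, a₁ ≠ a₂ → a₁ ≠ a₃ → a₂ ≠ a₃ → o ≠ a₁ → o ≠ a₂ → o ≠ a₃ → o ≠ b →
      b ≠ a₁ → b ≠ a₂ → b ≠ a₃ → MarkFree p ends o a₁ a₂ a₃ b →
      prob p (avoidAll ends a₂ {a₁}) ≠ 0 →
      (∀ e ∈ fracEdges p, TouchesReach p ends a₃ e → a₃ ∈ ends e) →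
      (∃ e ∈ fracEdges p, TouchesReach p ends a₃ e) →
      (¬ ∃ e ∈ fracEdges p, IsInternalEdge p ends a₃ e) → (¬ ∃ f, IsPendantEdge p ends a₃ f) →
      ∃ e ∈ fracEdges p, TouchesReach p ends a₃ e ∧ GoodEdgeSub p ends o a₁ a₂ a₃ b e

omit [IsStrictOrderedRing R] in
/-- `CPolarA3SubB2Lit_all` is weaker than `CPolarA3SubB2_all`. -/
theorem cpolarA3SubB2Lit_all_of_cpolarA3SubB2_all (h : CPolarA3SubB2_all R) :
    CPolarA3SubB2Lit_all R :=
  fun V E _ _ _ _ ends p hp o a₁ a₂ a₃ b h1 h2 h3 h4 h5 h6 h7 h8 h9 h10 hfree hQ _ hex hint hnp =>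
    h V E ends p hp o a₁ a₂ a₃ b h1 h2 h3 h4 h5 h6 h7 h8 h9 h10 hfree hQ hex hint hnp

omit [IsStrictOrderedRing R] in
/-- **The literal form suffices**: relocate the fractional reach-edges not incident to `a₃` one by
one; each relocation keeps the reach, the internal / pendant / touching status of every edge and
the mass of `Q`, and `GoodEdgeSub` transfers back. -/
theorem cpolarA3SubB2_all_of_lit (h : CPolarA3SubB2Lit_all R) : CPolarA3SubB2_all R := by
  intro V E _ _ _ _ ends p hp o a₁ a₂ a₃ b h1 h2 h3 h4 h5 h6 h7 h8 h9 h10 hfree hQ hex hint hnp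
  classical
  generalize hn : ((fracEdges p).filter fun e => TouchesReach p ends a₃ e ∧ a₃ ∉ ends e).card = n
  induction n using Nat.strong_induction_on generalizing ends with
  | _ n ih =>
    by_cases hlit : ∀ e ∈ fracEdges p, TouchesReach p ends a₃ e → a₃ ∈ ends e
    · exact h V E ends p hp o a₁ a₂ a₃ b h1 h2 h3 h4 h5 h6 h7 h8 h9 h10 hfree hQ hlit hex hint hnp
    · simp only [not_forall, exists_prop] at hlit
      obtain ⟨e, he, ht, hna⟩ := hlit
      have hfe : p e ≠ 0 ∧ p e ≠ 1 := by simpa [fracEdges] using he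
      obtain ⟨z, hze, hz⟩ := ht
      obtain ⟨u, hu⟩ : ∃ u, ends e = s(z, u) := by
        induction hends : ends e using Sym2.ind with
        | _ x y =>
          rw [hends] at hze
          rcases Sym2.mem_iff.1 hze with rfl | rfl
          · exact ⟨y, rfl⟩
          · exact ⟨x, Sym2.eq_swap⟩
      set ends' := Function.update ends e s(a₃, u) with hends'
      have hfilter : ((fracEdges p).filter fun e' => TouchesReach p ends' a₃ e' ∧ a₃ ∉ ends' e') =
          ((fracEdges p).filter fun e' => TouchesReach p ends a₃ e' ∧ a₃ ∉ ends e').erase e := by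
        ext e'
        simp only [Finset.mem_filter, Finset.mem_erase]
        by_cases hee : e' = e
        · subst hee
          simp only [hends', Function.update_self, Sym2.mem_mk_left, not_true_eq_false, and_false,
            ne_eq, not_true_eq_false, false_and]
        · simp only [hends', Function.update_of_ne hee, touchesReach_reloc_iff hfe.2 hz hu e',
            ne_eq, hee, not_false_eq_true, true_and]
      have hmem : e ∈ (fracEdges p).filter fun e' => TouchesReach p ends a₃ e' ∧ a₃ ∉ ends e' :=
        Finset.mem_filter.2 ⟨he, ⟨z, hze, hz⟩, hna⟩
      have hlt : ((fracEdges p).filter fun e' => TouchesReach p ends' a₃ e' ∧ a₃ ∉ ends' e').card <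
          n := by
        rw [hfilter, ← hn]; exact Finset.card_erase_lt_of_mem hmem
      have hfree' : MarkFree p ends' o a₁ a₂ a₃ b := (markFree_reloc_iff hfe.2 o a₁ a₂ b).2 hfree
      have hQ' : prob p (avoidAll ends' a₂ {a₁}) ≠ 0 := by
        rw [hends', prob_Q_reloc hfe.2 hz hu a₁ a₂]; exact hQ
      have hex' : ∃ e' ∈ fracEdges p, TouchesReach p ends' a₃ e' := by
        obtain ⟨e', he', ht'⟩ := hex
        exact ⟨e', he', (touchesReach_reloc_iff hfe.2 hz hu e').2 ht'⟩
      have hint' : ¬ ∃ e' ∈ fracEdges p, IsInternalEdge p ends' a₃ e' := by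
        rintro ⟨e', he', hi'⟩
        exact hint ⟨e', he', (isInternalEdge_reloc_iff hfe.2 hz hu e').1 hi'⟩
      have hnp' : ¬ ∃ f, IsPendantEdge p ends' a₃ f := by
        rintro ⟨f, hf⟩
        exact hnp ⟨f, (isPendantEdge_reloc_iff hfe.2 hz hu f).1 hf⟩
      obtain ⟨e', he', ht', hgood'⟩ := ih _ hlt ends' hfree' hQ' hex' hint' hnp' rfl
      have hfe' : p e' ≠ 0 ∧ p e' ≠ 1 := by simpa [fracEdges] using he'
      exact ⟨e', he', (touchesReach_reloc_iff hfe.2 hz hu e').1 ht',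
        goodEdgeSub_of_reloc hfe.2 hz hu o a₁ a₂ b e' hfe'.2 hgood'⟩

/-- **The crux from `HCovPlus_all` and (SUB) at one literal `a₃`-edge of every mark-free non-null
instance whose ≥ 2 fractional reach-edges are all literal boundary edges `{a₃, u}`.** -/
theorem HCov_all_of_cpolarA3SubB2Lit_all (hall : HCovPlus_all R) (h : CPolarA3SubB2Lit_all R) :
    HCov_all R :=
  HCov_all_of_cpolarA3SubB2_all R hall (cpolarA3SubB2_all_of_lit R h)

end Lit

end CPolarSubB2Lit

end Summit.Ventures.PercRepro2
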